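import Literature.MathematicalPhysics.QuantumFieldTheory.Balaban1983to89.B9Lemma21ShellCrossingZd

/-!
# `Balaban1983to89.B9GraphZdDegree` — [Balaban1984PropagatorsII] (2.45)–(2.46) p. 231, (2.2) p. 224: THE BLOCK GRAPH OF THE `ℤᵈ` FRAME IS UNIFORMLY LOCALLY
# FINITE — under the separation (2.2) (`Sep22Zd R`, `R ≥ 1`, `M > 0`) and the block laws (T)(V), a block of level `j` touches only blocks of levels `j − 1, j, j + 1`,
# and at most `3^d + 2·(L+2)^d` of them: the degree bound every counting form of Lemma 2.1 (2.61) starts from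

statement-level skeleton of published theorems with citation tags; proofs where landed; nothing here is a claim about the
Yang–Mills mass gap

PDF held: `paper:balaban1984-cmp96-propagators-rt-ii` ([4] of [B9]; journal page = PDF page + 222): p. 224 (2.2), p. 231 (2.45)–(2.46) («We will identify this set
with the set of corresponding blocks … admissible contours»), p. 234 Lemma 2.1 (2.61) «sup_y Σ_{y′} e^{−αδ₀d(y,y′)} ≤ c₁(α)» (page image read by this seat
2026-08-28); `B9SupplySockB9P3ZdFrame` (dag-n06-e: `graphZd`, `Touch`, `Sep22Zd`, `bigSideZd`) and `B9Lemma21ShellCrossingZd` (this seat: (2.60), the laws (T)(V))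
— BY NAME.

WHY THIS FILE (cell `pub-ymgap`, HUMAN RULING D-0062 ∕ D-0149; seat `pub-ymgap-dag-n06-w2` (g2), node N06 = [B9]; INTENT-5; count-neutral).  The row letter
«`Σ_v e^{−κ d(u,v)} ≤ S`» of the local-to-global summations (g0's `B9Eq347GlobalFromLocalZd`, this seat's Hölder line) is inhabited on a finite member with
`S = |𝔅|` (g0's `rowLetter_of_fintype`); any member-UNIFORM `S` — print's (2.61) — is a counting statement about the block graph.  Its first ingredient is that
the graph is uniformly locally finite: this file proves it for the frame's `graphZd` from the separation law (2.2) and the laws (T)(V) of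
`B9Lemma21ShellCrossingZd`, with an explicit degree bound.  (The counting itself — polynomial growth per level + (2.60) across levels under print's condition
(2.59) on `RM` — is NOT here.)

WHAT IS PROVED (0 sorry; proof lane — no `def`).
* §1 ★ `adj_level_near` — neighbours have ADJACENT LEVELS: `Adj u v ⇒ j_v ≤ j_u + 1 ∧ j_u ≤ j_v + 1` (`Sep22Zd R`, `1 ≤ R`, `0 < M`, `1 ≤ L`, (T), (V)): a block two
  or more levels below avoids `Ω_{j_v+1}` while the other lies in `Ω_{j_v+2}`, and (2.2) keeps such sites `> R⌈M⌉L^{j_v+1} ≥ 1` apart — they cannot touch.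
* §2 `adj_corner_bounds` — the corner arithmetic of touching cubes: `L^{j_v}·y′_μ ∈ [L^{j_u}y_μ − L^{j_v}, L^{j_u}y_μ + L^{j_u}]` for every coordinate.
* §3 `neighbors_subset_union`, `ncard_le_of_corner_box`, `card_Icc_box`, ★★ `ncard_neighbors_le` — the neighbour set of any block is FINITE with at most `3^d + 2·(L+2)^d` elements (level `j`: corners in
  `[y−1, y+1]^d`; level `j−1`: corners in `[Ly−1, Ly+L]^d`; level `j+1`: `L·y′ ∈ [y−L, y+1]^d`, counted through the injection `y′ ↦ L·y′`).
HONEST SCOPE.  Lattice-geometric bookkeeping; nothing of [B9]∕[4] asserted beyond the shape; constants crude (print's (2.61) constant `c₁(α) = 12c₀^d(α∕2)` is NOT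
reproduced — and is recorded REFUTED-AS-PRINTED on the torus lineage, `B6Lemma21Counterexample`); (T), (V), `Sep22Zd` DISPLAYED.  Count-neutral; N05∕N06 NOT
discharged; one finite lattice programme at fixed `ε`; R4 closes the conditional finite-𝕋⁴ rung `BalabanLadder.UV` only; nothing continuum ∕ ℝ⁴ ∕ OS ∕
mass-gap ∕ Clay.  Unit `pub-ymgap-dag-n06-w2` (g2), 2026-08-28.
-/

namespace Literature.MathematicalPhysics.QuantumFieldTheory.Balaban1983to89.B9GraphZdDegree

open B7Prop1Local (InBox)
open B8Ineq130 (tlo thi tlo_apply thi_apply)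
open B8LeafModelZd (ZdIdx)
open B9SupplySockB9P3ZdFrame (MemberZd BSite blockZd Touch graphZd bigSideZd Sep22Zd)
open B9Lemma21ShellCrossingZd (Omega_antitone blockZd_nonempty)
open LatticeNorms (linfDist linfDist_le_iff)

-- `Site` alone could resolve to the torus sites of `Setup.lean`; re-export the `ℤ^d` sites of `B7Prop1Explicit`.
export B7Prop1Explicit (Site)

variable {d L : ℕ} {x : MemberZd d L}
  (hT : ∀ y : BSite L x, blockZd L y.1.1 y.1.2 ⊆ x.i.Ω y.1.1)
  (hV : ∀ (y : BSite L x) (z : Site d), z ∈ blockZd L y.1.1 y.1.2 → ∀ j, j ≤ x.m → z ∈ x.i.Ω j → j ≤ y.1.1)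

/-! ## §1 Neighbours have adjacent levels -/

include hT hV in
/-- a block of level `≥ j_v + 2` cannot touch a block of level `j_v` (separation (2.2) at index `j_v + 1`).
[cite: Balaban1984PropagatorsII, (2.2) p.224, (2.46) p.231] -/
theorem not_touch_of_level_gap (hL : 1 ≤ L) {R : ℕ} (hR : 1 ≤ R) (hM : 0 < x.M) (hsep : Sep22Zd R x) {u v : BSite L x}
    (hgap : v.1.1 + 2 ≤ u.1.1) : ¬ Touch (blockZd L u.1.1 u.1.2) (blockZd L v.1.1 v.1.2) := by
  intro h
  obtain ⟨z, hz, z', hz', hzz⟩ := B9Lemma21ShellCrossingZd.Touch.exists_linfDist_le_one h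
  have hum : u.1.1 ≤ x.m := u.2.1
  -- `z ∈ Ω_{j_v+2}`, `z′ ∉ Ω_{j_v+1}`
  have hzin : z ∈ x.i.Ω (v.1.1 + 2) := (Omega_antitone x.i hgap) (hT u hz)
  have hz'out : z' ∉ x.i.Ω (v.1.1 + 1) := by
    intro hz'in
    have := hV v z' hz' (v.1.1 + 1) (by omega) hz'in
    omega
  have hfar := hsep (v.1.1 + 1) (by omega) z' hz'out z hzin
  rw [LatticeNorms.linfDist_comm] at hfar
  -- `R⌈M⌉L^{j_v+1} ≥ 1`
  have hM1 : 1 ≤ ⌈x.M⌉₊ := Nat.one_le_iff_ne_zero.mpr (by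
    intro h0; have := Nat.ceil_eq_zero.mp h0; linarith)
  have hbig : 1 ≤ R * bigSideZd x.M L (v.1.1 + 1) := by
    unfold B9SupplySockB9P3ZdFrame.bigSideZd
    exact Nat.one_le_iff_ne_zero.mpr (Nat.mul_ne_zero (by omega) (Nat.mul_ne_zero (by omega) (by positivity)))
  omega

include hT hV in
/-- ★ **NEIGHBOURS HAVE ADJACENT LEVELS**: `Adj u v ⇒ j_v ≤ j_u + 1 ∧ j_u ≤ j_v + 1`. [cite: Balaban1984PropagatorsII, (2.2) p.224, (2.46)–(2.47) p.231 («|j_l − j_{l+1}| = 1»)] -/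
theorem adj_level_near (hL : 1 ≤ L) {R : ℕ} (hR : 1 ≤ R) (hM : 0 < x.M) (hsep : Sep22Zd R x) {u v : BSite L x}
    (h : (graphZd L x).Adj u v) : v.1.1 ≤ u.1.1 + 1 ∧ u.1.1 ≤ v.1.1 + 1 := by
  constructor
  · by_contra hlt
    push Not at hlt
    exact not_touch_of_level_gap hT hV hL hR hM hsep (u := v) (v := u) (by omega) h.2.symm
  · by_contra hlt
    push Not at hlt
    exact not_touch_of_level_gap hT hV hL hR hM hsep (u := u) (v := v) (by omega) h.2

/-! ## §2 The corner arithmetic of touching cubes -/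

/-- **touching cubes have nearby corners**: if `Δ(u)` (level `j`, corner `y`) touches `Δ(v)` (level `i`, corner `y′`) then for every coordinate
`L^j y_μ − L^i ≤ L^i y′_μ ≤ L^j y_μ + L^j`. [cite: Balaban1985RegularSpaces, (1.28) p.81; Balaban1984PropagatorsII, (2.46) p.231] -/
theorem adj_corner_bounds {u v : BSite L x} (h : Touch (blockZd L u.1.1 u.1.2) (blockZd L v.1.1 v.1.2)) (μ : Fin d) :
    (L : ℤ) ^ u.1.1 * u.1.2 μ - (L : ℤ) ^ v.1.1 ≤ (L : ℤ) ^ v.1.1 * v.1.2 μ ∧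
      (L : ℤ) ^ v.1.1 * v.1.2 μ ≤ (L : ℤ) ^ u.1.1 * u.1.2 μ + (L : ℤ) ^ u.1.1 := by
  obtain ⟨z, hz, z', hz', hzz⟩ := h
  obtain ⟨h1, h2⟩ := hz μ
  obtain ⟨h3, h4⟩ := hz' μ
  rw [tlo_apply] at h1 h3
  rw [thi_apply] at h2 h4
  have h5 := hzz μ
  rw [abs_le] at h5
  constructor <;> nlinarith

/-! ## §3 The neighbour set is finite, with at most `3^d + 2·(L+2)^d` elements -/

/-- the neighbours of `u` split by level offset: same level, one below, one above, or two and more apart. [cite: Balaban1984PropagatorsII, (2.46) p.231 (bookkeeping)] -/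
theorem neighbors_subset_union (u : BSite L x) :
    {v : BSite L x | (graphZd L x).Adj u v} ⊆
      {v | (graphZd L x).Adj u v ∧ v.1.1 = u.1.1} ∪ ({v | (graphZd L x).Adj u v ∧ v.1.1 + 1 = u.1.1} ∪
        {v | (graphZd L x).Adj u v ∧ v.1.1 = u.1.1 + 1} ∪ {v | (graphZd L x).Adj u v ∧ (v.1.1 + 2 ≤ u.1.1 ∨ u.1.1 + 2 ≤ v.1.1)}) := by
  intro v hv
  simp only [Set.mem_setOf_eq, Set.mem_union]
  by_cases h1 : v.1.1 = u.1.1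
  · exact Or.inl ⟨hv, h1⟩
  by_cases h2 : v.1.1 + 1 = u.1.1
  · exact Or.inr (Or.inl (Or.inl ⟨hv, h2⟩))
  by_cases h3 : v.1.1 = u.1.1 + 1
  · exact Or.inr (Or.inl (Or.inr ⟨hv, h3⟩))
  · exact Or.inr (Or.inr ⟨hv, by omega⟩)

/-- **counting the neighbours of one level through their corners**: if every neighbour `v` of `u` at level offset described by `P` has `c • y′_v ∈ Icc lo hi`
(`c ≠ 0`), then there are at most `#Icc lo hi` of them. [cite: Balaban1984PropagatorsII, (2.46) p.231 (bookkeeping)] -/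
theorem ncard_le_of_corner_box (u : BSite L x) (P : ℕ → Prop) {c : ℤ} (hc : c ≠ 0) (lo hi : Site d)
    (hlev : ∀ v : BSite L x, (graphZd L x).Adj u v → P v.1.1 → ∀ v' : BSite L x, (graphZd L x).Adj u v' → P v'.1.1 → v.1.1 = v'.1.1)
    (hbox : ∀ v : BSite L x, (graphZd L x).Adj u v → P v.1.1 → c • v.1.2 ∈ Finset.Icc lo hi) :
    ({v : BSite L x | (graphZd L x).Adj u v ∧ P v.1.1}).Finite ∧
      ({v : BSite L x | (graphZd L x).Adj u v ∧ P v.1.1}).ncard ≤ (Finset.Icc lo hi).card := by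
  classical
  -- the injection `v ↦ c • y′_v` into the box
  have hinj : Set.InjOn (fun v : BSite L x => c • v.1.2) {v : BSite L x | (graphZd L x).Adj u v ∧ P v.1.1} := by
    intro v hv v' hv' hvv
    have hl : v.1.1 = v'.1.1 := hlev v hv.1 hv.2 v' hv'.1 hv'.2
    have hy : v.1.2 = v'.1.2 := by
      funext μ
      have := congrArg (fun f : Site d => f μ) hvv
      simp only [Pi.smul_apply, smul_eq_mul] at this
      exact mul_left_cancel₀ hc this
    exact Subtype.ext (Prod.ext hl hy)
  have hmaps : Set.MapsTo (fun v : BSite L x => c • v.1.2) {v : BSite L x | (graphZd L x).Adj u v ∧ P v.1.1} ↑(Finset.Icc lo hi) :=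
    fun v hv => hbox v hv.1 hv.2
  have hfin : ({v : BSite L x | (graphZd L x).Adj u v ∧ P v.1.1}).Finite :=
    Set.Finite.of_injOn hmaps hinj (Finset.finite_toSet _)
  refine ⟨hfin, ?_⟩
  calc ({v : BSite L x | (graphZd L x).Adj u v ∧ P v.1.1}).ncard
      ≤ (↑(Finset.Icc lo hi) : Set (Site d)).ncard := Set.ncard_le_ncard_of_injOn _ hmaps hinj (Finset.finite_toSet _)
    _ = (Finset.Icc lo hi).card := Set.ncard_coe_finset _

/-- the box of integer vectors `[a − r₁, a + r₂]^d` has `(r₁ + r₂ + 1)^d` elements (`r₁, r₂ ≥ 0`) — the corner count behind the degree bound. [cite: Balaban1984PropagatorsII, (2.46) p.231 (bookkeeping)] -/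
theorem card_Icc_box (a : Site d) {r₁ r₂ : ℤ} (h₁ : 0 ≤ r₁) (h₂ : 0 ≤ r₂) {n : ℕ} (hn : r₁ + r₂ + 1 = n) :
    (Finset.Icc (fun μ => a μ - r₁) (fun μ => a μ + r₂)).card = n ^ d := by
  rw [Pi.card_Icc]
  simp only [Int.card_Icc]
  have h : ∀ μ : Fin d, (a μ + r₂ + 1 - (a μ - r₁)).toNat = n := fun μ => by omega
  simp only [h, Finset.prod_const, Finset.card_univ, Fintype.card_fin]

include hT hV in
/-- ★★ **THE BLOCK GRAPH IS UNIFORMLY LOCALLY FINITE**: under (2.2) (`Sep22Zd R`, `1 ≤ R`, `0 < M`), `1 ≤ L` and the laws (T)(V), the neighbour set of every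
block is finite and has at most `3^d + 2·(L+2)^d` elements — the degree bound from which every counting form of (2.61) starts.
[cite: Balaban1984PropagatorsII, (2.2) p.224, (2.45)–(2.46) p.231, Lemma 2.1 (2.61) p.234] -/
theorem ncard_neighbors_le (hL : 1 ≤ L) {R : ℕ} (hR : 1 ≤ R) (hM : 0 < x.M) (hsep : Sep22Zd R x) (u : BSite L x) :
    ({v : BSite L x | (graphZd L x).Adj u v}).Finite ∧
      ({v : BSite L x | (graphZd L x).Adj u v}).ncard ≤ 3 ^ d + 2 * (L + 2) ^ d := by
  classical
  have hL0 : (0 : ℤ) < L := by exact_mod_cast (lt_of_lt_of_le zero_lt_one hL)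
  have hLj : ∀ j : ℕ, (0 : ℤ) < (L : ℤ) ^ j := fun j => pow_pos hL0 j
  -- level `j`: corners in `[y − 1, y + 1]^d`
  have hA := ncard_le_of_corner_box u (fun i => i = u.1.1) (c := 1) one_ne_zero (fun μ => u.1.2 μ - 1) (fun μ => u.1.2 μ + 1)
    (fun v _ hv v' _ hv' => hv.trans hv'.symm)
    (by
      intro v hv hvl
      rw [one_smul, Finset.mem_Icc]
      constructor <;> intro μ <;> dsimp only
      · obtain ⟨h1, -⟩ := adj_corner_bounds hv.2 μ
        rw [hvl] at h1
        have h' : (L : ℤ) ^ u.1.1 * (u.1.2 μ - 1) ≤ (L : ℤ) ^ u.1.1 * v.1.2 μ := by linarith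
        exact le_of_mul_le_mul_left h' (hLj _)
      · obtain ⟨-, h2⟩ := adj_corner_bounds hv.2 μ
        rw [hvl] at h2
        have h' : (L : ℤ) ^ u.1.1 * v.1.2 μ ≤ (L : ℤ) ^ u.1.1 * (u.1.2 μ + 1) := by linarith
        exact le_of_mul_le_mul_left h' (hLj _))
  -- level `j − 1`: corners in `[Ly − 1, Ly + L]^d`
  have hB := ncard_le_of_corner_box u (fun i => i + 1 = u.1.1) (c := 1) one_ne_zero
    (fun μ => (L : ℤ) * u.1.2 μ - 1) (fun μ => (L : ℤ) * u.1.2 μ + L)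
    (fun v _ hv v' _ hv' => by omega)
    (by
      intro v hv hvl
      rw [one_smul, Finset.mem_Icc]
      have hpow : (L : ℤ) ^ u.1.1 = (L : ℤ) ^ v.1.1 * L := by rw [← hvl, pow_succ]
      constructor <;> intro μ <;> dsimp only
      · obtain ⟨h1, -⟩ := adj_corner_bounds hv.2 μ
        rw [hpow] at h1
        have h' : (L : ℤ) ^ v.1.1 * ((L : ℤ) * u.1.2 μ - 1) ≤ (L : ℤ) ^ v.1.1 * v.1.2 μ := by linarith
        exact le_of_mul_le_mul_left h' (hLj _)
      · obtain ⟨-, h2⟩ := adj_corner_bounds hv.2 μ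
        rw [hpow] at h2
        have h' : (L : ℤ) ^ v.1.1 * v.1.2 μ ≤ (L : ℤ) ^ v.1.1 * ((L : ℤ) * u.1.2 μ + L) := by linarith
        exact le_of_mul_le_mul_left h' (hLj _))
  -- level `j + 1`: `L·y′ ∈ [y − L, y + 1]^d`
  have hC := ncard_le_of_corner_box u (fun i => i = u.1.1 + 1) (c := (L : ℤ)) hL0.ne' (fun μ => u.1.2 μ - L) (fun μ => u.1.2 μ + 1)
    (fun v _ hv v' _ hv' => hv.trans hv'.symm)
    (by
      intro v hv hvl
      rw [Finset.mem_Icc]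
      have hpow : (L : ℤ) ^ v.1.1 = (L : ℤ) ^ u.1.1 * L := by rw [hvl, pow_succ]
      constructor <;> intro μ <;> simp only [Pi.smul_apply, smul_eq_mul]
      · obtain ⟨h1, -⟩ := adj_corner_bounds hv.2 μ
        rw [hpow] at h1
        have h' : (L : ℤ) ^ u.1.1 * (u.1.2 μ - L) ≤ (L : ℤ) ^ u.1.1 * ((L : ℤ) * v.1.2 μ) := by linarith
        exact le_of_mul_le_mul_left h' (hLj _)
      · obtain ⟨-, h2⟩ := adj_corner_bounds hv.2 μ
        rw [hpow] at h2
        have h' : (L : ℤ) ^ u.1.1 * ((L : ℤ) * v.1.2 μ) ≤ (L : ℤ) ^ u.1.1 * (u.1.2 μ + 1) := by linarith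
        exact le_of_mul_le_mul_left h' (hLj _))
  -- no other levels
  have hD : {v : BSite L x | (graphZd L x).Adj u v ∧ (v.1.1 + 2 ≤ u.1.1 ∨ u.1.1 + 2 ≤ v.1.1)} = ∅ := by
    ext v
    simp only [Set.mem_setOf_eq, Set.mem_empty_iff_false, iff_false, not_and]
    intro hv hor
    have := adj_level_near hT hV hL hR hM hsep hv
    omega
  -- the boxes' sizes
  have hcardA : (Finset.Icc (fun μ => u.1.2 μ - 1) (fun μ => u.1.2 μ + 1)).card = 3 ^ d :=
    card_Icc_box u.1.2 zero_le_one zero_le_one (by norm_num)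
  have hcardB : (Finset.Icc (fun μ => (L : ℤ) * u.1.2 μ - 1) (fun μ => (L : ℤ) * u.1.2 μ + L)).card = (L + 2) ^ d :=
    card_Icc_box (fun μ => (L : ℤ) * u.1.2 μ) zero_le_one hL0.le (by push_cast; ring)
  have hcardC : (Finset.Icc (fun μ => u.1.2 μ - L) (fun μ => u.1.2 μ + 1)).card = (L + 2) ^ d :=
    card_Icc_box u.1.2 hL0.le zero_le_one (by push_cast; ring)
  rw [hcardA] at hA
  rw [hcardB] at hB
  rw [hcardC] at hC
  have hsub := neighbors_subset_union u
  rw [hD, Set.union_empty] at hsub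
  have hfin : ({v : BSite L x | (graphZd L x).Adj u v}).Finite := (hA.1.union (hB.1.union hC.1)).subset hsub
  refine ⟨hfin, ?_⟩
  calc ({v : BSite L x | (graphZd L x).Adj u v}).ncard
      ≤ ({v | (graphZd L x).Adj u v ∧ v.1.1 = u.1.1} ∪ ({v | (graphZd L x).Adj u v ∧ v.1.1 + 1 = u.1.1} ∪
          {v | (graphZd L x).Adj u v ∧ v.1.1 = u.1.1 + 1})).ncard := Set.ncard_le_ncard hsub (hA.1.union (hB.1.union hC.1))
    _ ≤ ({v | (graphZd L x).Adj u v ∧ v.1.1 = u.1.1}).ncard + (({v | (graphZd L x).Adj u v ∧ v.1.1 + 1 = u.1.1} ∪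
          {v | (graphZd L x).Adj u v ∧ v.1.1 = u.1.1 + 1})).ncard := Set.ncard_union_le _ _
    _ ≤ ({v | (graphZd L x).Adj u v ∧ v.1.1 = u.1.1}).ncard + (({v | (graphZd L x).Adj u v ∧ v.1.1 + 1 = u.1.1}).ncard +
          ({v | (graphZd L x).Adj u v ∧ v.1.1 = u.1.1 + 1}).ncard) := Nat.add_le_add_left (Set.ncard_union_le _ _) _
    _ ≤ 3 ^ d + ((L + 2) ^ d + (L + 2) ^ d) := Nat.add_le_add hA.2 (Nat.add_le_add hB.2 hC.2)
    _ = 3 ^ d + 2 * (L + 2) ^ d := by ring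

end Literature.MathematicalPhysics.QuantumFieldTheory.Balaban1983to89.B9GraphZdDegree
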